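import Mathlib.Analysis.InnerProductSpace.l2Space
import Literature.Analysis.FunctionSpaces.TorusVectorParseval
import HarnessLib

/-!
# Weak vanishing in `L²(T^d)` from vanishing Fourier modes

A norm-bounded family in a Hilbert space whose coordinates in a Hilbert basis all tend to zero
converges weakly to zero (`HilbertBasis.tendsto_inner_of_forall_tendsto_inner_basis`, along an
arbitrary filter). On the flat torus, with Mathlib's Fourier basis `UnitAddTorus.mFourierBasis`
of `L²(T^d)`, this gives the function-level statements used to read *mixing* as *weak
convergence*: if `g a ∈ L²(T^d)` are uniformly bounded in `L²` and `𝓕(g a)(k) → 0` for every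
frequency `k`, then `∫ conj(h) · g a → 0` for every `h ∈ L²`
(`Torus.tendsto_integral_conj_mul_of_tendsto_mFourierCoeff`), and the real form
`∫ r a · w → 0` (`Torus.tendsto_integral_mul_of_tendsto_mFourierCoeff`). This is the step
"`‖ρ(t)‖_{Ḣ⁻¹} → 0` and `‖ρ(t)‖_{L²} = 1`, hence `ρ(t) ⇀ 0` weakly in `L²`" of the perfect-mixing
constructions (Alberti–Crippa–Mazzucato 2019, §2.4; Cheskidov 2023, (3.9); Bruè–De Lellis 2023,
§4), decoupled from any rate.

## Mathlib

Used: `HilbertBasis.hasSum_repr`, `HilbertBasis.repr_apply_apply`, `UnitAddTorus.mFourierBasis`,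
`UnitAddTorus.mFourierBasis_repr`, `MeasureTheory.L2.inner_def`, `MemLp.toLp`; the transport
between the global `volume` and Mathlib's local Haar volume is the accepted
`Torus.volume_eq_pi_haarAddCircle` / `Torus.mFourierCoeff_congr_ae` (`TorusVectorParseval`).
Mathlib has no weak-convergence-from-coordinates lemma for Hilbert bases (searched
`tendsto_inner`, `HilbertBasis` + `weak`: none).

## References

* G. Alberti, G. Crippa, A. L. Mazzucato, *Exponential self-similar mixing by incompressible
  flows*, J. Amer. Math. Soc. 32 (2019), §2.4 (functional mixing scale `Ḣ⁻¹`).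
* A. Cheskidov, arXiv:2311.04182 (2023), §3, (3.9) (`ρ(t) ⇀ 0` weakly in `L²`).
-/

open Filter Topology MeasureTheory Set UnitAddTorus
open scoped InnerProductSpace ENNReal ComplexConjugate

noncomputable section

section
variable {ι 𝕜 E : Type*} [RCLike 𝕜] [NormedAddCommGroup E] [InnerProductSpace 𝕜 E]

/-- **Weak convergence to zero from a Hilbert basis.** In a Hilbert space with Hilbert basis
`b`, a norm-bounded family `x` (along any filter) whose coordinates `⟪b i, x⟫` all tend to `0`
converges weakly to `0`: `⟪y, x⟫ → 0` for every `y` (approximate `y` by a finite combination of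
basis vectors; the remainder is controlled by the norm bound). [folklore] -/
theorem HilbertBasis.tendsto_inner_of_forall_tendsto_inner_basis [CompleteSpace E]
    (b : HilbertBasis ι 𝕜 E) {α : Type*} {l : Filter α} {x : α → E} {M : ℝ}
    (hM : 0 ≤ M) (hx : ∀ a, ‖x a‖ ≤ M) (h : ∀ i, Tendsto (fun a => ⟪b i, x a⟫_𝕜) l (𝓝 0))
    (y : E) : Tendsto (fun a => ⟪y, x a⟫_𝕜) l (𝓝 0) := by
  rw [NormedAddGroup.tendsto_nhds_zero]
  intro ε hε
  -- a finite combination of basis vectors close to `y`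
  have hsum := b.hasSum_repr y
  have hε' : 0 < ε / (2 * (M + 1)) := by positivity
  obtain ⟨S, hS⟩ := (hsum.eventually (Metric.ball_mem_nhds y hε')).exists
  set yS : E := ∑ i ∈ S, b.repr y i • b i with hyS
  have hclose : ‖y - yS‖ < ε / (2 * (M + 1)) := by
    rw [← dist_eq_norm, dist_comm]; exact hS
  -- the finite part tends to zero
  have hfin : Tendsto (fun a => ⟪yS, x a⟫_𝕜) l (𝓝 0) := by
    have : (fun a => ⟪yS, x a⟫_𝕜) = fun a => ∑ i ∈ S, (starRingEnd 𝕜) (b.repr y i) * ⟪b i, x a⟫_𝕜 := by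
      funext a
      rw [hyS, sum_inner]
      simp only [inner_smul_left]
    rw [this]
    have h0 : (0 : 𝕜) = ∑ i ∈ S, (starRingEnd 𝕜) (b.repr y i) * 0 := by simp
    rw [h0]
    exact tendsto_finsetSum S fun i _ => (h i).const_mul _
  rw [NormedAddGroup.tendsto_nhds_zero] at hfin
  filter_upwards [hfin (ε / 2) (by positivity)] with a ha
  have hsplit : ⟪y, x a⟫_𝕜 = ⟪y - yS, x a⟫_𝕜 + ⟪yS, x a⟫_𝕜 := by
    rw [← inner_add_left, sub_add_cancel]
  rw [hsplit]
  calc ‖⟪y - yS, x a⟫_𝕜 + ⟪yS, x a⟫_𝕜‖ ≤ ‖⟪y - yS, x a⟫_𝕜‖ + ‖⟪yS, x a⟫_𝕜‖ := norm_add_le _ _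
    _ < ε / 2 + ε / 2 := by
        refine add_lt_add_of_le_of_lt ?_ ha
        calc ‖⟪y - yS, x a⟫_𝕜‖ ≤ ‖y - yS‖ * ‖x a‖ := norm_inner_le_norm _ _
          _ ≤ ε / (2 * (M + 1)) * M :=
              mul_le_mul hclose.le (hx a) (norm_nonneg _) hε'.le
          _ ≤ ε / 2 := by
              rw [div_mul_eq_mul_div, div_le_div_iff₀ (by positivity) (by positivity)]
              nlinarith
    _ = ε := by ring

end

namespace Literature.Analysis.FunctionSpaces.Torus

variable {d : Type*} [Fintype d]

/-- **Weak vanishing in `L²(T^d)` from vanishing Fourier modes.** Let `g a : T^d → ℂ`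
(`a` along a filter `l`) be square integrable with `∫ ‖g a‖² ≤ M` uniformly, and suppose every
Fourier coefficient tends to zero, `𝓕(g a)(k) → 0` along `l` for each `k ∈ ℤ^d`. Then
`∫ conj(h) · g a → 0` for every `h ∈ L²(T^d; ℂ)` (weak convergence to `0` in `L²`; Parseval /
the Hilbert basis `UnitAddTorus.mFourierBasis`). [folklore] -/
theorem tendsto_integral_conj_mul_of_tendsto_mFourierCoeff {α : Type*} {l : Filter α}
    {g : α → UnitAddTorus d → ℂ} {M : ℝ} (hg : ∀ a, MemLp (g a) 2 volume)
    (hgM : ∀ a, ∫ x, ‖g a x‖ ^ 2 ≤ M)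
    (hcoef : ∀ k : d → ℤ, Tendsto (fun a => mFourierCoeff (g a) k) l (𝓝 0))
    {h : UnitAddTorus d → ℂ} (hh : MemLp h 2 volume) :
    Tendsto (fun a => ∫ x, conj (h x) * g a x) l (𝓝 0) := by
  have hvol : (volume : Measure (UnitAddTorus d)) = (Measure.pi fun _ : d => AddCircle.haarAddCircle : Measure (UnitAddTorus d)) := volume_eq_pi_haarAddCircle
  have hg' : ∀ a, MemLp (g a) 2 (Measure.pi fun _ : d => AddCircle.haarAddCircle : Measure (UnitAddTorus d)) := fun a => hvol ▸ hg a
  have hh' : MemLp h 2 (Measure.pi fun _ : d => AddCircle.haarAddCircle : Measure (UnitAddTorus d)) := hvol ▸ hh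
  -- the `L²` classes
  set X : α → Lp ℂ 2 (Measure.pi fun _ : d => AddCircle.haarAddCircle : Measure (UnitAddTorus d)) := fun a => (hg' a).toLp (g a) with hX
  set Y : Lp ℂ 2 (Measure.pi fun _ : d => AddCircle.haarAddCircle : Measure (UnitAddTorus d)) := hh'.toLp h with hY
  -- inner products in `L²` are the integrals in question
  have hinner : ∀ a, ⟪Y, X a⟫_ℂ = ∫ x, conj (h x) * g a x := by
    intro a
    rw [MeasureTheory.L2.inner_def, hvol]
    refine integral_congr_ae ?_
    filter_upwards [(hg' a).coeFn_toLp, hh'.coeFn_toLp] with x hx hy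
    rw [hX, hY]
    simp only at hx hy ⊢
    rw [hx, hy, RCLike.inner_apply']
  -- norm bound
  have hnorm : ∀ a, ‖X a‖ ≤ Real.sqrt M := by
    intro a
    rw [Lp.norm_toLp, ← ENNReal.toReal_ofReal (Real.sqrt_nonneg M)]
    refine ENNReal.toReal_mono ENNReal.ofReal_ne_top ?_
    rw [(hg' a).eLpNorm_eq_integral_rpow_norm (by norm_num) (by norm_num)]
    simp only [ENNReal.toReal_ofNat, Real.rpow_two]
    rw [Real.sqrt_eq_rpow, one_div]
    have h0 : 0 ≤ ∫ x, ‖g a x‖ ^ 2 ∂(Measure.pi fun _ : d => AddCircle.haarAddCircle : Measure (UnitAddTorus d)) := integral_nonneg fun _ => sq_nonneg _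
    have h1 : ∫ x, ‖g a x‖ ^ 2 ∂(Measure.pi fun _ : d => AddCircle.haarAddCircle : Measure (UnitAddTorus d)) ≤ M := by rw [← hvol]; exact hgM a
    exact ENNReal.ofReal_le_ofReal (Real.rpow_le_rpow h0 h1 (by norm_num))
  -- coordinates in the Fourier basis
  have hbasis : ∀ k : d → ℤ, Tendsto (fun a => ⟪mFourierBasis (d := d) k, X a⟫_ℂ) l (𝓝 0) := by
    intro k
    have : (fun a => ⟪mFourierBasis (d := d) k, X a⟫_ℂ) = fun a => mFourierCoeff (g a) k := by
      funext a
      rw [← HilbertBasis.repr_apply_apply, mFourierBasis_repr]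
      exact mFourierCoeff_congr_ae (hvol ▸ (hg' a).coeFn_toLp) k
    rw [this]
    exact hcoef k
  have := (mFourierBasis (d := d)).tendsto_inner_of_forall_tendsto_inner_basis
    (Real.sqrt_nonneg M) hnorm hbasis Y
  simpa only [hinner] using this

/-- **Weak vanishing of real functions against real `L²` test functions** from vanishing
Fourier modes: if `r a : T^d → ℝ` are uniformly bounded in `L²`, `∫ (r a)² ≤ M`, and all
Fourier coefficients of `x ↦ (r a x : ℂ)` tend to zero along `l`, then `∫ r a · w → 0` for every
real `w ∈ L²(T^d)` (Cheskidov 2023, (3.9): the mixed scalars converge weakly to `0`). [folklore] -/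
theorem tendsto_integral_mul_of_tendsto_mFourierCoeff {α : Type*} {l : Filter α}
    {r : α → UnitAddTorus d → ℝ} {M : ℝ} (hr : ∀ a, MemLp (r a) 2 volume)
    (hrM : ∀ a, ∫ x, r a x ^ 2 ≤ M)
    (hcoef : ∀ k : d → ℤ, Tendsto (fun a => mFourierCoeff (fun x => (r a x : ℂ)) k) l (𝓝 0))
    {w : UnitAddTorus d → ℝ} (hw : MemLp w 2 volume) :
    Tendsto (fun a => ∫ x, r a x * w x) l (𝓝 0) := by
  have hg : ∀ a, MemLp (fun x => (r a x : ℂ)) 2 volume := fun a =>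
    (hr a).ofReal
  have hgM : ∀ a, ∫ x, ‖(r a x : ℂ)‖ ^ 2 ≤ M := fun a => by
    simpa only [Complex.norm_real, Real.norm_eq_abs, sq_abs] using hrM a
  have hh : MemLp (fun x => (w x : ℂ)) 2 volume := hw.ofReal
  have h := tendsto_integral_conj_mul_of_tendsto_mFourierCoeff hg hgM hcoef hh
  have heq : (fun a => ∫ x, conj ((w x : ℂ)) * (r a x : ℂ)) =
      fun a => ((∫ x, r a x * w x : ℝ) : ℂ) := by
    funext a
    rw [← integral_complex_ofReal]
    refine integral_congr_ae (ae_of_all _ fun x => ?_)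
    simp only [Complex.conj_ofReal, Complex.ofReal_mul]
    ring
  rw [heq] at h
  have h2 := (Complex.continuous_re.tendsto 0).comp h
  simp only [Complex.zero_re] at h2
  refine h2.congr fun a => ?_
  simp

end Literature.Analysis.FunctionSpaces.Torus

end
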